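import Summits.KontsevichZagierPeriods.KontsevichZagierPeriods.Theorems.SoloBlindTetraSemialg
import Summits.KontsevichZagierPeriods.KontsevichZagierPeriods.Theorems.SoloBlindLevelLinear
import HarnessLib

/-!
# The tetrahedral descent of `B(1/12,1/4)`, III: the moves

With the functions and identities of `SoloBlindTetraPrep`/`SoloBlindTetraDescent`, the chain of
Kontsevich–Zagier moves

  `β(1/12,1/4) ≡ [(0,1), G] ≡ [(-u₁,u₁), H] ≡ [(-u₁,0), H] + [(0,u₁), H]`
  `≡ [(0,u₁), H⁻] + [(0,u₁), H] ≡ [(0,u₁), 2C₀E] = 2C₀ • J`,  `J = [(0,u₁), E]`,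
  `J ≡ [(0,u₁²), L] ≡ [(0,1), M] = (1/(4u₁)) • β(1/2,1/4)`,

and likewise `β(5/12,1/4) = C₀(√3+1)u₁ • J`, gives, inside the rules:

* `betaQ_twelve_conj`:  `β(5/12,1/4) = ((√3-1)/2) • β(1/12,1/4)`
  (period check: `B(5/12,1/4)/B(1/12,1/4) = (√3-1)/2 = 0.36602…`);
* `betaQ_twelve_descent`: `β(1/12,1/4) = (C₀/(2u₁)) • β(1/2,1/4)`,
  `C₀/(2u₁) = √2 (9+6√3)^{1/4} = 2.96772…`;
* hence `β(5/12,1/4) ≐ β(1/12,1/4) ≐ β(1/4,1/4)`: the level-12 orbits `{3,4,5}`, `{1,3,8}`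
  join the class of `{3,3,6}` — two identities which the Gauss multiplication formulas (the
  standard Hodge classes) do NOT give; the exceptional Hodge class `(1,8,9,6) ∈ 𝔅²₁₂` of
  Aoki–Shioda is realised by an explicit one-dimensional chain.

References: N. Aoki, *Some new algebraic cycles on Fermat varieties*, J. Math. Soc. Japan 39
(1987); M. Kontsevich, D. Zagier, *Periods* (2001), §1.2; R. Vidūnas, *Expressions for values
of the gamma function*, Kyushu J. Math. 59 (2005) (the value `Γ(1/12)` in terms of `Γ(1/3)`,
`Γ(1/4)`).
-/

noncomputable section

open Set MeasureTheory MvPolynomial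

namespace Summit.KontsevichZagierPeriods.KontsevichZagierPeriods.Theorems

namespace SoloBlind

open Literature.ModelTheory.ExponentialFields (IsSemialgebraic)
open Literature.NumberTheory.Transcendental
open Literature.NumberTheory.Transcendental.KZ

/-! ## The representations -/

/-- `(0,u₁) ⊆ (-u₁,u₁)`. -/
theorem tR_sub : Ioo (0:ℝ) tU ⊆ Ioo (-tU) tU :=
  Ioo_subset_Ioo_left (neg_lt_zero.mpr tU_pos).le

/-- `(-u₁,0) ⊆ (-u₁,u₁)`. -/
theorem tLf_sub : Ioo (-tU) (0:ℝ) ⊆ Ioo (-tU) tU := Ioo_subset_Ioo_right tU_pos.le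

/-- `[(0,1), G]`. -/
def tetGRep : IntegralRep 1 := lineRep (Ioo 0 1) tetG mix_line_sa sa_tetG integrableOn_tetG

/-- `[(0,1), v G(v)]`. -/
def tetG₁Rep : IntegralRep 1 :=
  lineRep (Ioo 0 1) (fun v => v * tetG v) mix_line_sa sa_tetG₁ integrableOn_tetG₁

/-- `[(-u₁,u₁), H]`. -/
def tetHRep : IntegralRep 1 :=
  lineRep (Ioo (-tU) tU) tetH tI_sa (sa_tetH tI_sa Subset.rfl) integrableOn_tetH

/-- `[(-u₁,u₁), H₁]`. -/
def tetH₁Rep : IntegralRep 1 :=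
  lineRep (Ioo (-tU) tU) tetH₁ tI_sa (sa_tetH₁ tI_sa Subset.rfl) integrableOn_tetH₁

/-- `[(-u₁,0), H]`. -/
def tetHL : IntegralRep 1 :=
  lineRep (Ioo (-tU) 0) tetH tLf_sa (sa_tetH tLf_sa tLf_sub) integrableOn_tetH_left

/-- `[(0,u₁), H]`. -/
def tetHR : IntegralRep 1 :=
  lineRep (Ioo 0 tU) tetH tR_sa (sa_tetH tR_sa tR_sub) integrableOn_tetH_right

/-- `[(0,u₁), H⁻]`. -/
def tetHnR : IntegralRep 1 :=
  lineRep (Ioo 0 tU) tetHn tR_sa (sa_tetHn tR_sa tR_sub) integrableOn_tetHn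

/-- `[(-u₁,0), H₁]`. -/
def tetH₁L : IntegralRep 1 :=
  lineRep (Ioo (-tU) 0) tetH₁ tLf_sa (sa_tetH₁ tLf_sa tLf_sub) integrableOn_tetH₁_left

/-- `[(0,u₁), H₁]`. -/
def tetH₁R : IntegralRep 1 :=
  lineRep (Ioo 0 tU) tetH₁ tR_sa (sa_tetH₁ tR_sa tR_sub) integrableOn_tetH₁_right

/-- `[(0,u₁), H₁⁻]`. -/
def tetH₁nR : IntegralRep 1 :=
  lineRep (Ioo 0 tU) tetH₁n tR_sa (sa_tetH₁n tR_sa tR_sub) integrableOn_tetH₁n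

/-- `2C₀` is algebraic. -/
theorem isAlgebraic_two_tC0 : IsAlgebraic ℚ (2 * tC0) := isAlgebraic_of_K₀ (2 * tC0K) (by simp)

/-- `C₀(√3+1)u₁` is algebraic. -/
theorem isAlgebraic_coeff₁ : IsAlgebraic ℚ (tC0 * (r3 + 1) * tU) :=
  isAlgebraic_of_K₀ (tC0K * (r3K + 1) * tUK) (by simp)

/-- `[(0,u₁), 2C₀ E]`. -/
def tetSumR : IntegralRep 1 :=
  lineRep (Ioo 0 tU) (fun u => 2 * tC0 * tetE u) tR_sa (sa_const_tetE tR_sa tR_sub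
    isAlgebraic_two_tC0) integrableOn_two_tC0_tetE

/-- `[(0,u₁), C₀(√3+1)u₁ E]`. -/
def tetSum₁R : IntegralRep 1 :=
  lineRep (Ioo 0 tU) (fun u => tC0 * (r3 + 1) * tU * tetE u) tR_sa (sa_const_tetE tR_sa tR_sub
    isAlgebraic_coeff₁) integrableOn_coeff_tetE

/-- `J = [(0,u₁), E]`. -/
def tetERep : IntegralRep 1 :=
  lineRep (Ioo 0 tU) tetE tR_sa (sa_tetE tR_sa tR_sub) integrableOn_tetE

/-- `[(0,u₁²), L]`. -/
def tetLRep : IntegralRep 1 := lineRep (Ioo 0 (tU ^ 2)) tetL tS_sa sa_tetL integrableOn_tetL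

/-- `[(0,1), M]`. -/
def tetMRep : IntegralRep 1 := lineRep (Ioo 0 1) tetM mix_line_sa sa_tetM integrableOn_tetM

/-! ## The moves -/

/-- **Move 1:** `[(0,1), G] ≡ β(1/12,1/4)` (substitution `t = v³`). -/
theorem tetGRep_sub_betaRep :
    of tetGRep - of (betaRep (1 / 12) (1 / 4) (by norm_num) (by norm_num)) ∈ relations := by
  unfold tetGRep betaRep
  exact lineRep_subst (fun v => v ^ 3) (fun v => 3 * v ^ 2)
    ((isSemialgebraicFunOn_aeval mix_line_sa (X 0 ^ 3 : MvPolynomial (Fin 1) ℚ)).congr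
      fun x _ => by simp)
    (fun v _ => (hasDerivAt_cube v).hasDerivWithinAt) injOn_cube image_cube
    (fun v hv => tet_cube hv)

/-- **Move 1′:** `[(0,1), v G(v)] ≡ β(5/12,1/4)` (substitution `t = v³`). -/
theorem tetG₁Rep_sub_betaRep :
    of tetG₁Rep - of (betaRep (5 / 12) (1 / 4) (by norm_num) (by norm_num)) ∈ relations := by
  unfold tetG₁Rep betaRep
  exact lineRep_subst (fun v => v ^ 3) (fun v => 3 * v ^ 2)
    ((isSemialgebraicFunOn_aeval mix_line_sa (X 0 ^ 3 : MvPolynomial (Fin 1) ℚ)).congr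
      fun x _ => by simp)
    (fun v _ => (hasDerivAt_cube v).hasDerivWithinAt) injOn_cube image_cube
    (fun v hv => tet_cube₁ hv)

/-- **Move 2:** `[(-u₁,u₁), H] ≡ [(0,1), G]` (the Möbius substitution `v = μ(u)`). -/
theorem tetHRep_sub_tetGRep : of tetHRep - of tetGRep ∈ relations := by
  unfold tetHRep tetGRep
  exact lineRep_subst tetMu tetMu' sa_tetMu
    (fun u hu => (hasDerivAt_tetMu (ne_of_lt (hu.2.trans tU_lt_one))).hasDerivWithinAt)
    injOn_tetMu image_tetMu (fun u hu => tet_pullback hu)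

/-- **Move 2′:** `[(-u₁,u₁), H₁] ≡ [(0,1), v G(v)]`. -/
theorem tetH₁Rep_sub_tetG₁Rep : of tetH₁Rep - of tetG₁Rep ∈ relations := by
  unfold tetH₁Rep tetG₁Rep
  exact lineRep_subst tetMu tetMu' sa_tetMu
    (fun u hu => (hasDerivAt_tetMu (ne_of_lt (hu.2.trans tU_lt_one))).hasDerivWithinAt)
    injOn_tetMu image_tetMu (fun u hu => tet_pullback₁ hu)

/-- Splitting `(-u₁,u₁)` at `0` (domain additivity; the point `0` is null), for any integrand. -/
theorem tet_split {f : ℝ → ℝ} {hf : IsSemialgebraicFunOn ℚ (line (Ioo (-tU) tU)) (fun x => f (x 0))}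
    {hi : IntegrableOn f (Ioo (-tU) tU)}
    {hf₁ : IsSemialgebraicFunOn ℚ (line (Ioo (-tU) 0)) (fun x => f (x 0))}
    {hi₁ : IntegrableOn f (Ioo (-tU) 0)}
    {hf₂ : IsSemialgebraicFunOn ℚ (line (Ioo 0 tU)) (fun x => f (x 0))}
    {hi₂ : IntegrableOn f (Ioo 0 tU)} :
    of (lineRep (Ioo (-tU) tU) f tI_sa hf hi) - (of (lineRep (Ioo (-tU) 0) f tLf_sa hf₁ hi₁)
      + of (lineRep (Ioo 0 tU) f tR_sa hf₂ hi₂)) ∈ relations := by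
  have h0 := tU_pos
  suffices h : of (lineRep (Ioo (-tU) tU) f tI_sa hf hi) - ∑ i ∈ (Finset.univ : Finset (Fin 2)),
      of (![lineRep (Ioo (-tU) 0) f tLf_sa hf₁ hi₁, lineRep (Ioo 0 tU) f tR_sa hf₂ hi₂] i)
        ∈ relations by
    rw [Fin.sum_univ_two, Matrix.cons_val_zero, Matrix.cons_val_one,
      Matrix.cons_val_fin_one] at h
    exact h
  refine of_sub_sum_of_mem_relations (Finset.univ : Finset (Fin 2)) _
    ![lineRep (Ioo (-tU) 0) f tLf_sa hf₁ hi₁, lineRep (Ioo 0 tU) f tR_sa hf₂ hi₂] ?_ ?_ ?_ ?_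
  · intro i _
    fin_cases i
    · refine measure_mono_null (fun x hx => ?_) measure_empty
      have h1 : x 0 ∈ Ioo (-tU) 0 := hx.1
      exact hx.2 (show x 0 ∈ Ioo (-tU) tU from tLf_sub h1)
    · refine measure_mono_null (fun x hx => ?_) measure_empty
      have h1 : x 0 ∈ Ioo (0:ℝ) tU := hx.1
      exact hx.2 (show x 0 ∈ Ioo (-tU) tU from tR_sub h1)
  · intro i _
    fin_cases i <;> exact fun _ _ => rfl
  · have hnull : volume {x : Fin 1 → ℝ | x 0 = 0} = 0 := by
      rw [volume_pi]
      exact Measure.pi_hyperplane (fun _ : Fin 1 => (volume : Measure ℝ)) 0 0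
    refine measure_mono_null (fun x hx => ?_) hnull
    have hx0 : x 0 ∈ Ioo (-tU) tU := hx.1
    have hn := hx.2
    simp only [Finset.mem_univ, iUnion_true, mem_iUnion, not_exists] at hn
    by_contra hc
    rcases lt_or_gt_of_ne hc with hlt | hgt
    · exact hn 0 (show x 0 ∈ Ioo (-tU) 0 from ⟨hx0.1, hlt⟩)
    · exact hn 1 (show x 0 ∈ Ioo (0:ℝ) tU from ⟨hgt, hx0.2⟩)
  · intro i _ j _ hij
    refine measure_mono_null (fun x hx => ?_) measure_empty
    fin_cases i <;> fin_cases j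
    · exact (hij rfl).elim
    · have h1 : x 0 ∈ Ioo (-tU) 0 := hx.1
      have h2 : x 0 ∈ Ioo (0:ℝ) tU := hx.2
      exact (lt_irrefl _ (h1.2.trans h2.1)).elim
    · have h1 : x 0 ∈ Ioo (0:ℝ) tU := hx.1
      have h2 : x 0 ∈ Ioo (-tU) 0 := hx.2
      exact (lt_irrefl _ (h2.2.trans h1.1)).elim
    · exact (hij rfl).elim

/-- **Move 3:** `[(-u₁,u₁), H] ≡ [(-u₁,0), H] + [(0,u₁), H]`. -/
theorem tetHRep_split : of tetHRep - (of tetHL + of tetHR) ∈ relations := tet_split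

/-- **Move 3′:** `[(-u₁,u₁), H₁] ≡ [(-u₁,0), H₁] + [(0,u₁), H₁]`. -/
theorem tetH₁Rep_split : of tetH₁Rep - (of tetH₁L + of tetH₁R) ∈ relations := tet_split

/-- **Move 4:** `[(-u₁,0), H] ≡ [(0,u₁), H⁻]` (the reflection `u ↦ -u`; `E` is even). -/
theorem tetHL_sub_tetHnR : of tetHL - of tetHnR ∈ relations := by
  unfold tetHL tetHnR
  refine lineRep_subst (fun u => -u) (fun _ => -1)
    ((isSemialgebraicFunOn_aeval tLf_sa (-X 0 : MvPolynomial (Fin 1) ℚ)).congr fun x _ => by simp)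
    (fun u _ => (hasDerivAt_neg u).hasDerivWithinAt) (fun x _ y _ h => neg_inj.mp h)
    tet_image_neg fun u _ => ?_
  rw [← tetH_neg, neg_neg, abs_neg, abs_one, mul_one]

/-- **Move 4′:** `[(-u₁,0), H₁] ≡ [(0,u₁), H₁⁻]`. -/
theorem tetH₁L_sub_tetH₁nR : of tetH₁L - of tetH₁nR ∈ relations := by
  unfold tetH₁L tetH₁nR
  refine lineRep_subst (fun u => -u) (fun _ => -1)
    ((isSemialgebraicFunOn_aeval tLf_sa (-X 0 : MvPolynomial (Fin 1) ℚ)).congr fun x _ => by simp)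
    (fun u _ => (hasDerivAt_neg u).hasDerivWithinAt) (fun x _ y _ h => neg_inj.mp h)
    tet_image_neg fun u _ => ?_
  rw [← tetH₁_neg, neg_neg, abs_neg, abs_one, mul_one]

/-- **Move 5:** `[(0,u₁), 2C₀E] ≡ [(0,u₁), H] + [(0,u₁), H⁻]` (integrand additivity:
`C₀(1-u)E + C₀(1+u)E = 2C₀E`). -/
theorem tetSumR_sub_sub : of tetSumR - of tetHR - of tetHnR ∈ relations :=
  of_sub_sub_mem_relations_of_add rfl rfl fun x _ => by
    simp only [tetSumR, tetHR, tetHnR, lineRep_integrand, tetH, tetHn]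
    ring

/-- **Move 5′:** `[(0,u₁), C₀(√3+1)u₁E] ≡ [(0,u₁), H₁] + [(0,u₁), H₁⁻]`. -/
theorem tetSum₁R_sub_sub : of tetSum₁R - of tetH₁R - of tetH₁nR ∈ relations :=
  of_sub_sub_mem_relations_of_add rfl rfl fun x _ => by
    simp only [tetSum₁R, tetH₁R, tetH₁nR, lineRep_integrand, tetH₁, tetH₁n]
    ring

/-- `[(0,u₁), 2C₀E] = 2C₀ · J` literally. -/
theorem tetSumR_eq : tetSumR = tetERep.constMul (2 * tC0) isAlgebraic_two_tC0 :=
  IntegralRep.ext' rfl rfl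

/-- `[(0,u₁), C₀(√3+1)u₁E] = C₀(√3+1)u₁ · J` literally. -/
theorem tetSum₁R_eq : tetSum₁R = tetERep.constMul (tC0 * (r3 + 1) * tU) isAlgebraic_coeff₁ :=
  IntegralRep.ext' rfl rfl

/-- **Move 6:** `J ≡ [(0,u₁²), L]` (substitution `s = u²`). -/
theorem tetERep_sub_tetLRep : of tetERep - of tetLRep ∈ relations := by
  unfold tetERep tetLRep
  exact lineRep_subst (fun u => u ^ 2) (fun u => 2 * u)
    ((isSemialgebraicFunOn_aeval tR_sa (X 0 ^ 2 : MvPolynomial (Fin 1) ℚ)).congr fun x _ => by simp)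
    (fun u _ => (hasDerivAt_sq u).hasDerivWithinAt) injOn_sq image_sq (fun u hu => tet_sq hu)

/-- **Move 7:** `[(0,1), M] ≡ [(0,u₁²), L]` (the Möbius substitution `s = ν(x)`). -/
theorem tetMRep_sub_tetLRep : of tetMRep - of tetLRep ∈ relations := by
  unfold tetMRep tetLRep
  exact lineRep_subst tetNu tetNu' sa_tetNu
    (fun x hx => (hasDerivAt_tetNu (tetNu_den_pos hx.2).ne').hasDerivWithinAt)
    injOn_tetNu image_tetNu (fun x hx => tet_nu hx)

/-- `(4u₁)⁻¹` is algebraic. -/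
theorem isAlgebraic_inv_four_tU : IsAlgebraic ℚ (4 * tU)⁻¹ :=
  isAlgebraic_of_K₀ (4 * tUK)⁻¹ (by simp)

/-- `[(0,1), M] = (4u₁)⁻¹ · β(1/2,1/4)` literally. -/
theorem tetMRep_eq : tetMRep = (betaRep (1 / 2) (1 / 4) (by norm_num) (by norm_num)).constMul
    (4 * tU)⁻¹ isAlgebraic_inv_four_tU :=
  IntegralRep.ext' rfl rfl

/-! ## The descent in `Q` -/

/-- `β(1/12,1/4) = 2C₀ • J`. -/
theorem betaQ_twelve_one_eq :
    betaQ (1 / 12) (1 / 4) = (2 * tC0K) • mkQ (of tetERep) := by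
  have h1 : betaQ (1 / 12) (1 / 4) = mkQ (of tetHRep) := by
    rw [betaQ_eq (by norm_num) (by norm_num)]
    exact ((mkQ_eq_mkQ_iff.mpr tetGRep_sub_betaRep).symm).trans
      (mkQ_eq_mkQ_iff.mpr tetHRep_sub_tetGRep).symm
  have h2 : mkQ (of tetHRep) = mkQ (of tetHL) + mkQ (of tetHR) := by
    rw [← map_add, mkQ_eq_mkQ_iff]
    exact tetHRep_split
  have h3 : mkQ (of tetHL) = mkQ (of tetHnR) := mkQ_eq_mkQ_iff.mpr tetHL_sub_tetHnR
  have h4 : mkQ (of tetSumR) = mkQ (of tetHR) + mkQ (of tetHnR) := by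
    rw [← map_add, mkQ_eq_mkQ_iff]
    have h := tetSumR_sub_sub
    rwa [sub_sub] at h
  have h5 : mkQ (of tetSumR) = (2 * tC0K) • mkQ (of tetERep) := by
    rw [tetSumR_eq, mkQ_constMul]
    exact congrArg (· • mkQ (of tetERep)) (Subtype.ext (by simp))
  rw [h1, h2, h3, add_comm, ← h4, h5]

/-- `β(5/12,1/4) = C₀(√3+1)u₁ • J`. -/
theorem betaQ_twelve_five_eq :
    betaQ (5 / 12) (1 / 4) = (tC0K * (r3K + 1) * tUK) • mkQ (of tetERep) := by
  have h1 : betaQ (5 / 12) (1 / 4) = mkQ (of tetH₁Rep) := by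
    rw [betaQ_eq (by norm_num) (by norm_num)]
    exact ((mkQ_eq_mkQ_iff.mpr tetG₁Rep_sub_betaRep).symm).trans
      (mkQ_eq_mkQ_iff.mpr tetH₁Rep_sub_tetG₁Rep).symm
  have h2 : mkQ (of tetH₁Rep) = mkQ (of tetH₁L) + mkQ (of tetH₁R) := by
    rw [← map_add, mkQ_eq_mkQ_iff]
    exact tetH₁Rep_split
  have h3 : mkQ (of tetH₁L) = mkQ (of tetH₁nR) := mkQ_eq_mkQ_iff.mpr tetH₁L_sub_tetH₁nR
  have h4 : mkQ (of tetSum₁R) = mkQ (of tetH₁R) + mkQ (of tetH₁nR) := by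
    rw [← map_add, mkQ_eq_mkQ_iff]
    have h := tetSum₁R_sub_sub
    rwa [sub_sub] at h
  have h5 : mkQ (of tetSum₁R) = (tC0K * (r3K + 1) * tUK) • mkQ (of tetERep) := by
    rw [tetSum₁R_eq, mkQ_constMul]
    exact congrArg (· • mkQ (of tetERep)) (Subtype.ext (by simp))
  rw [h1, h2, h3, add_comm, ← h4, h5]

/-- `J = (4u₁)⁻¹ • β(1/2,1/4)`. -/
theorem tetJ_eq : mkQ (of tetERep) = (4 * tUK)⁻¹ • betaQ (1 / 2) (1 / 4) := by
  have h1 : mkQ (of tetERep) = mkQ (of tetMRep) :=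
    (mkQ_eq_mkQ_iff.mpr tetERep_sub_tetLRep).trans (mkQ_eq_mkQ_iff.mpr tetMRep_sub_tetLRep).symm
  rw [h1, tetMRep_eq, mkQ_constMul, betaQ_eq (by norm_num) (by norm_num)]
  exact congrArg (· • mkQ (of _)) (Subtype.ext (by simp))

/-- The conjugation coefficient `(√3-1)/2 ∈ K₀`. -/
def tetC₁ : K₀ := (r3K - 1) / 2

/-- `(tetC₁ : ℝ) = (√3-1)/2`. -/
theorem coe_tetC₁ : ((tetC₁ : K₀) : ℝ) = (r3 - 1) / 2 := by simp [tetC₁]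

/-- `tetC₁ ≠ 0`. -/
theorem tetC₁_ne_zero : tetC₁ ≠ 0 := by
  intro h
  have h' := congrArg (fun z : K₀ => (z : ℝ)) h
  simp only [coe_tetC₁, ZeroMemClass.coe_zero] at h'
  linarith [one_lt_r3]

/-- The descent coefficient `C₀/(2u₁) ∈ K₀` (`= √2(9+6√3)^{1/4}`). -/
def tetC₂ : K₀ := 2 * tC0K * (4 * tUK)⁻¹

/-- `(tetC₂ : ℝ) = C₀/(2u₁)`. -/
theorem coe_tetC₂ : ((tetC₂ : K₀) : ℝ) = tC0 / (2 * tU) := by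
  have htU : tU ≠ 0 := tU_pos.ne'
  simp [tetC₂]
  field_simp
  ring

/-- `tetC₂ ≠ 0`. -/
theorem tetC₂_ne_zero : tetC₂ ≠ 0 := by
  intro h
  have h' := congrArg (fun z : K₀ => (z : ℝ)) h
  simp only [coe_tetC₂, ZeroMemClass.coe_zero] at h'
  have : 0 < tC0 / (2 * tU) := div_pos tC0_pos (by linarith [tU_pos])
  linarith

/-- **`β(5/12,1/4) = ((√3-1)/2) • β(1/12,1/4)`** inside the Kontsevich–Zagier rules: the two
level-12 orbits `{3,4,5}` and `{1,3,8}` merge (`(√3+1)u₁ = √3-1`). -/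
theorem betaQ_twelve_conj : betaQ (5 / 12) (1 / 4) = tetC₁ • betaQ (1 / 12) (1 / 4) := by
  rw [betaQ_twelve_five_eq, betaQ_twelve_one_eq, smul_smul]
  congr 1
  apply Subtype.ext
  have h3 := r3_sq
  simp [tetC₁]
  unfold tU
  linear_combination (-tC0) * h3

/-- **`β(1/12,1/4) = (C₀/(2u₁)) • β(1/2,1/4)`** inside the Kontsevich–Zagier rules: the
tetrahedral descent from level `12` to level `4`. -/
theorem betaQ_twelve_descent : betaQ (1 / 12) (1 / 4) = tetC₂ • betaQ (1 / 2) (1 / 4) := by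
  rw [betaQ_twelve_one_eq, tetJ_eq, smul_smul]
  rfl

/-- `β(5/12,1/4) ≐ β(1/12,1/4)`. -/
theorem betaQ_propTo_twelve_conj : PropTo (betaQ (5 / 12) (1 / 4)) (betaQ (1 / 12) (1 / 4)) :=
  ⟨tetC₁, tetC₁_ne_zero, betaQ_twelve_conj⟩

/-- `β(1/12,1/4) ≐ β(1/2,1/4)`. -/
theorem betaQ_propTo_twelve_half : PropTo (betaQ (1 / 12) (1 / 4)) (betaQ (1 / 2) (1 / 4)) :=
  ⟨tetC₂, tetC₂_ne_zero, betaQ_twelve_descent⟩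

/-- **`β(1/12,1/4) ≐ β(1/4,1/4)`**: with the duplication `β(1/4,1/4) = √2 • β(1/4,1/2)`, the
level-12 orbit `{1,3,8}` (and with it `{3,4,5}`) joins the class of the lemniscatic
`{3,3,6} ∋ B(1/4,1/4)`. -/
theorem betaQ_propTo_twelve_quarter : PropTo (betaQ (1 / 12) (1 / 4)) (betaQ (1 / 4) (1 / 4)) := by
  refine betaQ_propTo_twelve_half.trans ?_
  rw [betaQ_symm (by norm_num) (by norm_num)]
  exact PropTo.symm ⟨duplCoeff (1 / 4), duplCoeff_ne_zero _, betaQ_dupl_quarter⟩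

/-- `β(5/12,1/4) ≐ β(1/4,1/4)`. -/
theorem betaQ_propTo_twelve_five_quarter :
    PropTo (betaQ (5 / 12) (1 / 4)) (betaQ (1 / 4) (1 / 4)) :=
  betaQ_propTo_twelve_conj.trans betaQ_propTo_twelve_quarter

end SoloBlind

end Summit.KontsevichZagierPeriods.KontsevichZagierPeriods.Theorems
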